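import Literature.AlgebraicGeometry.HodgeTheory.WeilClassesFieldDefiniteQuaternionMatricesEndLevel
import Literature.AlgebraicGeometry.HodgeTheory.WeilClassesFieldIsogenyInvariance
import Literature.AlgebraicGeometry.HodgeTheory.WeilClassesFieldPolynomialOfSymmetricDecomposable
import Literature.AlgebraicGeometry.HodgeTheory.DivisorLefschetzGroupEigenspaceSplitting
import Literature.AlgebraicGeometry.ComplexMultiplication.EndAlgebraCommSubalgebraDegreeBound
import Mathlib.LinearAlgebra.Lagrange
import Mathlib.LinearAlgebra.Eigenspace.Triangularizable
import Mathlib.LinearAlgebra.Eigenspace.Minpoly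
import HarnessLib

/-!
# Moonen–Zarhin's Criterion (2), THE TYPE-3 ROW WITH `m = 1`: for `End⁰(A) = D = ℚ(ψ)⟨α, β⟩` a definite quaternion
# algebra over `E = ℚ(ψ)`, the Weil classes of a subfield `F = ℚ(φ) ⊆ D` are decomposable iff `φ^* ∈ E ⊗ ℂ`, and
# ALL non-zero classes of `W_F` are exceptional iff `φ^* ∉ E ⊗ ℂ` («`Y` is of Type 3, `m = 1` and `F ⊄ E`»), on `A`
# itself, from `End(A)`-level data (Moonen–Zarhin 1998 §1, Criterion (2))

Layer `Literature/AlgebraicGeometry/HodgeTheory`; THEOREMS ONLY — no definition, no named fact, no `sorry` (D-0026, net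
debt 0).  The `m = 1` companion of the seat's `WeilClassesFieldDefiniteQuaternionMatricesEndLevel` (g23-#5: the parity
dichotomy for `W_F(A^{n+1})`, `F ⊆ M_{n+1}(D)`), stated on `A` WITHOUT the biproduct `⨁_{Fin 1} A`: the print's other
type-3 row.  Method: the power `A¹ = ⨁_{Fin 1} A` is isomorphic to `A` by `π₀`, an `F`-equivariant isogeny, so g23-#5 at
`n = 0` transports to `A` (the seat's `WeilClassesFieldIsogenyInvariance`: decomposability, exceptionality and the
eigenspaces `V_ρ`, `ker(ψ^* - z)` correspond under `π₀^*`); and on `A` the per-place divisibility «`dim ker(ψ^* - z) ∣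
dim(V_ρ ∩ ker(ψ^* - z))` for all `ρ, z`» is EQUIVALENT to «`φ^*` is a complex polynomial in `ψ^*`» (§1, linear
algebra: a commuting pair of diagonalisable operators; Lagrange interpolation), i.e. to `φ^* ∈ E ⊗ ℂ = ℂ[ψ^*]`.  The
decomposable direction is also immediate from the tree: `ℂ[ψ^*]` consists of `Q_h`-symmetric operators
(`polarizationPairingOne_symm_of_mem_adjoin_singleton`) and a Rosati-symmetric generator has decomposable Weil classes
(`weilClassesField_le_divisorClassesSpan_of_symm`).

## The print

B. J. J. Moonen, Yu. G. Zarhin, *Weil classes on abelian varieties*, J. reine angew. Math. **496** (1998) 83–92 =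
arXiv:alg-geom/9612017 [MoonenZarhin1998WeilClasses] (held text `paper:arxiv-alg-geom_9612017`), §1, VERBATIM: «we may
even assume that `X = Y^m` for some `m ≥ 1`, where `Y` is simple.  Let `D = End⁰(Y)`, let `E` be the center of `D` …»
(chunk p0002 L45–L51); «(In fact, if `m ≥ 2` or if `X` is of type 1 or 2, then we simply have `Δ = D`.  If `m = 1` then
`Δ = B`.)» (chunk p0002 L96–L97); Criterion (2) (chunk p0003 L59–L80): «Suppose `F ↪ End⁰(X)` is a subfield such that
`W_F = ⋀ʳ V_X` consists of Hodge classes … Then either all classes in `W_F` are decomposable, or all non-zero classes in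
`W_F` are exceptional; this last possibility occurs precisely in the following cases: `Y` is of Type 3, `m = 1` and
`F ⊄ E`, `Y` is of Type 3, `m ≥ 2` and the integer `2m · [E:ℚ]/[F:ℚ]` is odd, …»; its proof (chunk p0003 L82–L90):
«First assume that `X` is either of type 1, 2 or of type 3 with `m = 1` … We claim that, in these cases, `G_div(X)`
acts as the identity on `W_F` if and only if `F ⊆ B`. …»; here `B = E` for type 3 with `m = 1` (the print's Table 1,
referred to at chunk p0002 L63–L64 and L96–L97 «If `m = 1` then `Δ = B`»; the table itself is not in the held text
extraction — the identification is the one the case list of Criterion (2) uses: the `†`-symmetric elements of a definite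
quaternion algebra with its canonical involution are its centre).
H. Lange, Ch. Birkenhake, *Complex Abelian Varieties* [LangeBirkenhake1992], §1.1 (the rational representation), Ch. 5
§5 (type III: `End⁰` a totally definite quaternion algebra over a totally real field, Rosati = quaternion conjugation;
held PDF p. 138).

## The carrier and the data (as in g23-#5)

`V = H¹(A(ℂ); ℂ) = complexBetti A.X 1`, `χ^* = pullbackOne A χ`, `Q_h = polarizationPairingOne A.X h (dim A - 1)` for a
class `h ∈ B¹(A) ⊗ ℂ` with `h^{dim A} ≠ 0` and `Q_h` non-degenerate; `W_F ⊗ ℂ = weilClassesField A φ P (2m)` for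
`P(φ) = 0`, `P ∈ ℤ[T]` monic irreducible of degree `e`, `e · 2m = 2 dim A`; `𝒟ᵐ ⊗ ℂ = divisorClassesSpan A.X A.dim m`;
`V_ρ = ker(φ^* - ρ)`.  THE TYPE-3 PRESENTATION: `ψ ∈ End(A)` Rosati-symmetric with `Q(ψ) = 0` (`Q` monic irreducible
over `ℚ`; `E = ℚ(ψ)`), `α, β ∈ End(A)` Rosati-SKEW with `ψα = αψ`, `ψβ = βψ`, `αβ = -βα`, `α² = a(ψ)`, `β² = b(ψ)`
(`a, b ∈ ℤ[X]` non-vanishing at the complex roots of `Q`), and «`End⁰(A) = D = ℚ⟨ψ, α, β⟩`»: every `g ∈ End(A)` has a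
non-zero integer multiple in `ℤ⟨ψ, α, β⟩` (`hD`).  «`F ⊆ E`» is read on the carrier as `φ^* ∈ E ⊗ ℂ = ℂ[ψ^*] =
Algebra.adjoin ℂ {ψ^*}`, and in `End(A)` as `N φ = f(ψ)` (`N ≠ 0`, `f ∈ ℤ[X]`), resp. — necessary form — «`φ` is central
in `End(A)`» (`E = Z(D)`).

## What is proved

* §1 (linear algebra, `Literature.LinearAlgebra`) `eigenspace_inf_eigenspace_eq_bot_or_le_of_mem_adjoin_singleton`,
  `finrank_eigenspace_dvd_finrank_inf_of_mem_adjoin_singleton` — a polynomial `S = f(T)` meets every eigenspace of `T`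
  in `0` or in all of it, so `dim ker(T - z) ∣ dim(ker(S - ρ) ∩ ker(T - z))`; and the converse
  **`mem_adjoin_singleton_of_forall_finrank_eigenspace_dvd`**: if `T` is diagonalisable with eigenvalues in a finite
  set, `S` commutes with `T`, and `dim ker(T - z) ∣ dim(ker(S - ρ) ∩ ker(T - z))` whenever the intersection is non-zero,
  then `S ∈ ℂ[T]` (an eigenvector of `S` in `ker(T - z)` forces `ker(T - z) ⊆ ker(S - ρ_z)`; interpolate `z ↦ ρ_z`).
* §2 (the power `A¹`) `biproduct_map_const_eval₂_eq_zero` (`P(φ) = 0 ⟹ P(⊕φ) = 0` in `End(A^{n+1})`),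
  `isIsogeny_biproduct_π_fin_one` (`π₀ : ⨁_{Fin 1} A ⟶ A` is an isogeny — an isomorphism),
  `finrank_eigenspace_inf_eigenspace_eq_of_isIsogeny_of_comm` (`dim(V_ρ ∩ ker(ψ^* - z))` is invariant along an
  equivariant isogeny), `pullbackOne_comm_of_mem_adjoin_singleton_of_forall_exists_zsmul_mem_closure_triple` (under
  `hD`, `ℂ[ψ^*]` commutes with every pull-back), and the general dichotomy lemma
  `weilClassesField_inf_divisorClassesSpan_eq_bot_iff_not_le_divisorClassesSpan` (`W_F ⊗ ℂ ⊓ 𝒟ᵐ ⊗ ℂ = ⊥ ↔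
  ¬ W_F ⊗ ℂ ≤ 𝒟ᵐ ⊗ ℂ`, from the tree's `S(A)(h)(ℂ)`-criteria and `W_F ≠ 0`).
* §3 THE ROW.  `weilClassesField_le_divisorClassesSpan_of_mem_adjoin_singleton_of_symm` («`F ⊆ E ⊗ ℂ`», `ψ`
  Rosati-symmetric ⟹ decomposable — any `A`), `weilClassesField_le_divisorClassesSpan_of_zsmul_eq_eval₂_of_symm`
  (End-level «`F ⊆ E`»: `N φ = f(ψ)` ⟹ decomposable);
  **`weilClassesField_le_divisorClassesSpan_iff_mem_adjoin_singleton_of_definiteQuaternionOver_End`** — under the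
  type-3 presentation, `W_F ⊗ ℂ ≤ 𝒟ᵐ ⊗ ℂ ↔ φ^* ∈ ℂ[ψ^*]`;
  **`weilClassesField_inf_divisorClassesSpan_eq_bot_iff_not_mem_adjoin_singleton_of_definiteQuaternionOver_End`** —
  `W_F ⊗ ℂ ⊓ 𝒟ᵐ ⊗ ℂ = ⊥ ↔ φ^* ∉ ℂ[ψ^*]` («all non-zero classes exceptional precisely when `F ⊄ E`»);
  `comp_comm_of_weilClassesField_le_divisorClassesSpan_of_definiteQuaternionOver_End` (decomposable ⟹ `φ` central in
  `End(A)`: «`F ⊆ Z(End⁰ A) = E`») and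
  `weilClassesField_inf_divisorClassesSpan_eq_bot_of_comp_ne_comp_of_definiteQuaternionOver_End` (`φ` not central ⟹
  all non-zero Weil classes exceptional).
* §4 CENTRE `ℚ` (`D = ℚ⟨α, β⟩`, `α² = [a]`, `β² = [b]`, `E = ℚ`, so «`F ⊆ E`» means `F = ℚ`):
  `weilClassesField_le_divisorClassesSpan_iff_exists_eq_smul_one_of_definiteQuaternion_End` (`W_F ⊗ ℂ ≤ 𝒟ᵐ ⊗ ℂ ↔
  φ^* ∈ ℂ · 1`), **`weilClassesField_le_divisorClassesSpan_iff_natDegree_eq_one_of_definiteQuaternion_End`** (`↔ deg P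
  = 1`) and `weilClassesField_inf_divisorClassesSpan_eq_bot_iff_natDegree_ne_one_of_definiteQuaternion_End` (every
  `φ ∈ End(A)` generating a field `F ≠ ℚ` has ONLY exceptional non-zero Weil classes).

## Where Criterion (2) now sits in the tree (orientation only; every cell names theorem-only files of this layer)

type 1 (`D = E` totally real): `m = 1` `WeilClassesFieldPolynomialOfSymmetricDecomposable`, `m ≥ 2`
`WeilClassesFieldPolynomialMatricesDecomposable` / `…RealMultiplicationMatricesDecomposable` / `…SubringMatricesDecomposable`
— all decomposable.  type 2 (indefinite quaternion over `E`): `m = 1` `WeilClassesFieldDecomposableOfMatrixUnits` /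
`…QuaternionOverRealFieldDecomposable` / `…QuaternionEndLevel`, `m ≥ 2` `…QuaternionMatricesDecomposable` /
`…QuaternionOverRealFieldMatricesDecomposable` / `…QuaternionMatricesEndLevel` — all decomposable.  type 3 (definite
quaternion over `E`): `m = 1` THIS FILE (`F ⊄ E` ⟺ exceptional, `E ⊗ ℂ` form), `m ≥ 2` `…OrthogonalCornersParity` /
`…OrthogonalCornersExceptional` / `…DefiniteQuaternionMatricesDecomposable` / `…Exceptional` / `…EndLevel` (parity of
the per-place exponents).  type 4, `d = 1` (`D = E` CM): `…CMCentreMatricesDecomposable` / `…ExceptionalOfCentralTorus` /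
`…CMCentreDichotomy` (`θ = 0` ⟺ balanced multiplicities, `m ≥ 1`); `F ⊄ B` in general: `…ExceptionalOfNotMemAdjoin`.
type 4 with `d ≥ 2`: not in the tree.

## Scope (honest column)

As in g23-#2/#4/#5: no Albert classification, simplicity or `X ∼ Y^m` is used — «type 3, `m = 1`» is the PRESENTATION
`ψ, α, β` of `End⁰(A)` with the stated Rosati signs plus `hD`; that a simple complex abelian variety of type III admits it
is Table 1 and Albert's classification, NOT proved here.  «`F ⊆ E`» is formalised as `φ^* ∈ E ⊗ ℂ = ℂ[ψ^*]` on the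
carrier; at `End(A)`-level the file proves «`N φ ∈ ℤ[ψ]` ⟹ decomposable» and «decomposable ⟹ `φ` central», but NOT
the purely algebraic bridge «`φ` central in `D` ⟹ `N φ ∈ ℤ[ψ]`» (`Z(D) = E`), which needs the normal form of `D`.
`h` is any class with `h^{dim A} ≠ 0` and `Q_h` non-degenerate; everything is on `ℂ`-points of Milne's `S(A)(h)`.

## References

* [MoonenZarhin1998WeilClasses] B. J. J. Moonen, Yu. G. Zarhin, Weil classes on abelian varieties, J. reine angew.
  Math. 496 (1998) 83–92; arXiv:alg-geom/9612017: §1 (chunk p0002 L43–L118), Criterion (2) and its proof (chunk p0003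
  L59–L111; p0004 L1–L27).
* [Milne1999LefschetzClasses] J. S. Milne, Lefschetz classes on abelian varieties, Duke Math. J. 96 (1999), §1 p. 643,
  Thm. 3.2, Cor. 4.5.
* [LangeBirkenhake1992] H. Lange, Ch. Birkenhake, Complex Abelian Varieties, Grundlehren 302 (1992), §1.1, Ch. 5 §5
  (PDF p. 138).
* [vanGeemen1994HodgeAV] B. van Geemen, An introduction to the Hodge conjecture for abelian varieties, LNM 1594 (1994),
  3.6–3.7 (isogenies on `H¹`).
* [HornJohnson2013] R. A. Horn, C. R. Johnson, Matrix Analysis, 2nd ed. (CUP 2013), §1.3 (similarity; commuting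
  diagonalisable matrices, polynomials in a matrix).

## Provenance

Lane `lit-hodgefound` (Track 2, Layer A), prover seat `lit-hodgefound-p21` (generation 24), row g24-#1 (successor note
(a) of generation 23: the type-3 row with `m = 1`).
-/

noncomputable section

open CategoryTheory CategoryTheory.Limits
open Polynomial Module

/-! ### §1 Linear algebra: a polynomial in `T` versus the eigenspaces of `T`, and the converse by interpolation -/

namespace Literature.LinearAlgebra

section PolynomialInT

variable {M : Type*} [AddCommGroup M] [Module ℂ M]

/-- `q(T) x = q(z) x` on `ker(T - z)`. [folklore] -/
private theorem aeval_apply_of_mem_eigenspace' {T : Module.End ℂ M} {z : ℂ} {x : M} (hx : x ∈ T.eigenspace z) (q : ℂ[X]) :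
    aeval T q x = q.eval z • x := by
  have hk : ∀ k : ℕ, (T ^ k) x = z ^ k • x := by
    intro k
    induction k with
    | zero => rw [pow_zero, pow_zero, Module.End.one_apply, one_smul]
    | succ k ih =>
      rw [pow_succ', Module.End.mul_apply, ih, map_smul, Module.End.mem_eigenspace_iff.1 hx, smul_smul, ← pow_succ]
  induction q using Polynomial.induction_on' with
  | add p q hp hq => rw [map_add, LinearMap.add_apply, hp, hq, eval_add, add_smul]
  | monomial k c =>
    rw [aeval_monomial, eval_monomial, Module.End.mul_apply, hk, map_smul, Module.algebraMap_end_apply, smul_smul,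
      mul_comm]

/-- **A polynomial in `T` meets each eigenspace of `T` in nothing or in everything**: for `S ∈ ℂ[T]` and all `ρ, z`,
either `ker(S - ρ) ∩ ker(T - z) = 0` or `ker(T - z) ⊆ ker(S - ρ)` (`S = f(T)` acts on `ker(T - z)` as the scalar
`f(z)`). [cite: HornJohnson2013, §1.3 (polynomials in a matrix; commuting matrices)] -/
theorem eigenspace_inf_eigenspace_eq_bot_or_le_of_mem_adjoin_singleton {T S : Module.End ℂ M}
    (hS : S ∈ Algebra.adjoin ℂ ({T} : Set (Module.End ℂ M))) (ρ z : ℂ) :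
    S.eigenspace ρ ⊓ T.eigenspace z = ⊥ ∨ T.eigenspace z ≤ S.eigenspace ρ := by
  rw [Algebra.adjoin_singleton_eq_range_aeval] at hS
  obtain ⟨q, rfl⟩ := hS
  by_cases hρ : q.eval z = ρ
  · refine Or.inr fun x hx ↦ Module.End.mem_eigenspace_iff.2 ?_
    change aeval T q x = ρ • x
    rw [aeval_apply_of_mem_eigenspace' hx, hρ]
  · refine Or.inl (eq_bot_iff.2 fun x hx ↦ ?_)
    obtain ⟨hxS, hxT⟩ := hx
    have h1 : ρ • x = q.eval z • x := by
      rw [← Module.End.mem_eigenspace_iff.1 hxS]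
      exact aeval_apply_of_mem_eigenspace' hxT q
    have h2 : (ρ - q.eval z) • x = 0 := by rw [sub_smul, h1, sub_self]
    exact (Submodule.mem_bot ℂ).2 ((smul_eq_zero.1 h2).resolve_left (sub_ne_zero.2 (Ne.symm hρ)))

/-- **`dim ker(T - z) ∣ dim(ker(S - ρ) ∩ ker(T - z))` for `S ∈ ℂ[T]`** (the intersection is `0` or `ker(T - z)`).
[cite: HornJohnson2013, §1.3 (polynomials in a matrix)] -/
theorem finrank_eigenspace_dvd_finrank_inf_of_mem_adjoin_singleton {T S : Module.End ℂ M}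
    (hS : S ∈ Algebra.adjoin ℂ ({T} : Set (Module.End ℂ M))) (ρ z : ℂ) :
    Module.finrank ℂ ↥(T.eigenspace z) ∣ Module.finrank ℂ ↥(S.eigenspace ρ ⊓ T.eigenspace z) := by
  rcases eigenspace_inf_eigenspace_eq_bot_or_le_of_mem_adjoin_singleton hS ρ z with h | h
  · rw [h, finrank_bot]
    exact dvd_zero _
  · rw [inf_eq_right.2 h]

/-- An endomorphism preserving a non-zero subspace of a finite-dimensional complex vector space has an eigenvector in
it. [folklore] -/
private theorem exists_eigenvector_of_mapsTo' [FiniteDimensional ℂ M] {W : Submodule ℂ M} (hW : W ≠ ⊥)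
    {S : Module.End ℂ M} (hS : Set.MapsTo S W W) : ∃ c : ℂ, ∃ v ∈ W, v ≠ 0 ∧ S v = c • v := by
  haveI : Nontrivial W := Submodule.nontrivial_iff_ne_bot.2 hW
  obtain ⟨c, hc⟩ := Module.End.exists_eigenvalue (S.restrict hS)
  obtain ⟨⟨v, hv⟩, hv'⟩ := hc.exists_hasEigenvector
  refine ⟨c, v, hv, fun h0 ↦ hv'.2 (Subtype.ext h0), ?_⟩
  have h := congrArg Subtype.val hv'.apply_eq_smul
  simpa [LinearMap.restrict_apply] using h

/-- **THE CONVERSE BY INTERPOLATION: `S ∈ ℂ[T]`.**  Let `T` be diagonalisable (`⨆_z ker(T - z) = ⊤`) with eigenvalues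
in a finite set `s`, and let `S` commute with `T`.  If `dim ker(T - z) ∣ dim(ker(S - ρ) ∩ ker(T - z))` whenever this
intersection is non-zero, then `S` is a polynomial in `T`: an eigenvector of `S` inside `ker(T - z) ≠ 0` (invariant
under `S`) gives `ρ_z` with `0 < dim(ker(S - ρ_z) ∩ ker(T - z))`, hence `= dim ker(T - z)`, i.e. `ker(T - z) ⊆
ker(S - ρ_z)`; the Lagrange polynomial `f` with `f(z) = ρ_z` on `s` has `f(T) = S` on every `ker(T - z)`, hence
everywhere. [cite: HornJohnson2013, §1.3 (commuting matrices, simultaneous diagonalisation, polynomials in a matrix)] -/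
theorem mem_adjoin_singleton_of_forall_finrank_eigenspace_dvd [FiniteDimensional ℂ M] {T S : Module.End ℂ M}
    {s : Finset ℂ} (htop : ⨆ z, T.eigenspace z = ⊤) (hs : ∀ z, T.eigenspace z ≠ ⊥ → z ∈ s) (hST : S * T = T * S)
    (hdvd : ∀ z ρ, S.eigenspace ρ ⊓ T.eigenspace z ≠ ⊥ →
      Module.finrank ℂ ↥(T.eigenspace z) ∣ Module.finrank ℂ ↥(S.eigenspace ρ ⊓ T.eigenspace z)) :
    S ∈ Algebra.adjoin ℂ ({T} : Set (Module.End ℂ M)) := by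
  classical
  -- every non-zero eigenspace of `T` lies inside one eigenspace of `S`
  have key : ∀ z, T.eigenspace z ≠ ⊥ → ∃ ρ, T.eigenspace z ≤ S.eigenspace ρ := by
    intro z hz
    have hmaps : Set.MapsTo S (T.eigenspace z) (T.eigenspace z) := by
      intro x hx
      rw [SetLike.mem_coe, Module.End.mem_eigenspace_iff] at hx ⊢
      rw [← Module.End.mul_apply, ← hST, Module.End.mul_apply, hx, map_smul]
    obtain ⟨ρ, v, hv, hv0, hSv⟩ := exists_eigenvector_of_mapsTo' hz hmaps
    refine ⟨ρ, ?_⟩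
    have hne : S.eigenspace ρ ⊓ T.eigenspace z ≠ ⊥ := by
      rw [Submodule.ne_bot_iff]
      exact ⟨v, ⟨Module.End.mem_eigenspace_iff.2 hSv, hv⟩, hv0⟩
    have hle : S.eigenspace ρ ⊓ T.eigenspace z ≤ T.eigenspace z := inf_le_right
    have hpos : 0 < Module.finrank ℂ ↥(S.eigenspace ρ ⊓ T.eigenspace z) := by
      rw [pos_iff_ne_zero, Ne, Submodule.finrank_eq_zero]
      exact hne
    have heq : Module.finrank ℂ ↥(S.eigenspace ρ ⊓ T.eigenspace z) = Module.finrank ℂ ↥(T.eigenspace z) :=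
      le_antisymm (Submodule.finrank_mono hle) (Nat.le_of_dvd hpos (hdvd z ρ hne))
    exact inf_eq_right.1 (Submodule.eq_of_le_of_finrank_eq hle heq)
  choose! c hc using key
  -- interpolate `z ↦ c z` on `s`
  set f : ℂ[X] := Lagrange.interpolate s id c with hfdef
  have hfz : ∀ z ∈ s, f.eval z = c z := by
    intro z hz
    have h := Lagrange.eval_interpolate_at_node c (Set.injOn_id (s : Set ℂ)) hz
    simpa only [id] using h
  have hSf : S = aeval T f := by
    refine LinearMap.ext fun x ↦ ?_
    have hx : x ∈ ⨆ z, T.eigenspace z := by rw [htop]; exact Submodule.mem_top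
    refine Submodule.iSup_induction (motive := fun x ↦ S x = aeval T f x) _ hx (fun z x hxz ↦ ?_)
      (by rw [map_zero, map_zero]) (fun x y hx' hy' ↦ by rw [map_add, map_add, hx', hy'])
    by_cases hx0 : x = 0
    · rw [hx0, map_zero, map_zero]
    have hz : T.eigenspace z ≠ ⊥ := by
      rw [Submodule.ne_bot_iff]
      exact ⟨x, hxz, hx0⟩
    rw [Module.End.mem_eigenspace_iff.1 (hc z hz hxz), aeval_apply_of_mem_eigenspace' hxz, hfz z (hs z hz)]
  rw [hSf]
  exact Polynomial.aeval_mem_adjoin_singleton _ _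

end PolynomialInT

end Literature.LinearAlgebra

/-! ### §2 The power `A¹ = ⨁_{Fin 1} A`, eigenvalues of pull-backs, commutation under `hD`, and the general dichotomy -/

namespace Literature.AlgebraicGeometry.HodgeTheory

open Literature.AlgebraicTopology.SingularHomology
open Literature.AlgebraicGeometry.Motives
open Literature.AlgebraicGeometry.VanGeemen1994 (hodgeClassSpan pullbackOne detOnEigenspace)
open Literature.AlgebraicGeometry.Milne1999
open Literature.Geometry.Kaehler (lefschetzPow)
open Literature.Barriers.HodgeConjecture (divisorClassesSpan)
open Literature.LinearAlgebra

section PowerOne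

variable {A : AbelianVariety ℂ} {n : ℕ}

/-- **`P(φ) = 0 ⟹ P(⊕φ) = 0` in `End(A^{n+1})`**: the diagonal `End(A) → End(A^{n+1}) = M_{n+1}(End A)`, `g ↦ ⊕g`, is
a ring homomorphism (a morphism into a biproduct is determined by its components), so it commutes with the evaluation
of integer polynomials. [cite: LangeBirkenhake1992, §1.1] [cite: MoonenZarhin1998WeilClasses, §1 Table 1 («X = Y^m, End⁰(X) = M_m(D)»; chunk p0002 L60–L84)] -/
theorem biproduct_map_const_eval₂_eq_zero {φ : A ⟶ A} {P : Polynomial ℤ}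
    (hφ : Polynomial.eval₂ (Int.castRingHom (CategoryTheory.End A)) (φ : CategoryTheory.End A) P = 0) :
    Polynomial.eval₂ (Int.castRingHom (CategoryTheory.End (⨁ (fun _ : Fin (n + 1) => A))))
      ((biproduct.map fun _ : Fin (n + 1) => φ) : CategoryTheory.End (⨁ (fun _ : Fin (n + 1) => A))) P = 0 := by
  let D : CategoryTheory.End A →+* CategoryTheory.End (⨁ (fun _ : Fin (n + 1) => A)) :=
    { toFun := fun g ↦ End.of (biproduct.map fun _ : Fin (n + 1) => End.asHom g)
      map_one' := by
        change End.of (biproduct.map fun _ : Fin (n + 1) => 𝟙 A) = End.of (𝟙 (⨁ (fun _ : Fin (n + 1) => A)))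
        congr 1
        exact biproduct.hom_ext _ _ fun j ↦ by rw [biproduct.map_π, Category.comp_id, Category.id_comp]
      map_mul' := fun f g ↦ by
        change End.of (biproduct.map fun _ : Fin (n + 1) => End.asHom g ≫ End.asHom f) =
          End.of ((biproduct.map fun _ : Fin (n + 1) => End.asHom g) ≫
            biproduct.map fun _ : Fin (n + 1) => End.asHom f)
        congr 1
        exact biproduct.hom_ext _ _ fun j ↦ by
          simp only [biproduct.map_π, Category.assoc, biproduct.map_π_assoc]
      map_zero' := by
        change End.of (biproduct.map fun _ : Fin (n + 1) => (0 : A ⟶ A)) =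
          End.of (0 : (⨁ (fun _ : Fin (n + 1) => A)) ⟶ ⨁ (fun _ : Fin (n + 1) => A))
        congr 1
        exact biproduct.hom_ext _ _ fun j ↦ by rw [biproduct.map_π, Limits.comp_zero, Limits.zero_comp]
      map_add' := fun f g ↦ by
        change End.of (biproduct.map fun _ : Fin (n + 1) => End.asHom f + End.asHom g) =
          End.of ((biproduct.map fun _ : Fin (n + 1) => End.asHom f) +
            biproduct.map fun _ : Fin (n + 1) => End.asHom g)
        congr 1
        exact biproduct.hom_ext _ _ fun j ↦ by
          rw [biproduct.map_π, Preadditive.add_comp, biproduct.map_π, biproduct.map_π, Preadditive.comp_add] }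
  have h1 := Polynomial.hom_eval₂ P (Int.castRingHom (CategoryTheory.End A)) D (φ : CategoryTheory.End A)
  rw [hφ, map_zero, RingHom.ext_int (D.comp (Int.castRingHom (CategoryTheory.End A)))
    (Int.castRingHom (CategoryTheory.End (⨁ (fun _ : Fin (n + 1) => A))))] at h1
  exact h1.symm

/-- **`π₀ : A¹ = ⨁_{Fin 1} A ⟶ A` is an isogeny** — indeed an isomorphism with inverse `ι₀` («everything only depends on
`X` up to isogeny … `X = Y^m` for some `m ≥ 1`», here `m = 1`). [cite: MoonenZarhin1998WeilClasses, §1 (chunk p0002 L45–L46)]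
[cite: MumfordAV1970, §19 (products and their projections)] -/
theorem isIsogeny_biproduct_π_fin_one :
    AbelianVariety.IsIsogeny (biproduct.π (fun _ : Fin (0 + 1) => A) 0) := by
  have hπι : biproduct.π (fun _ : Fin (0 + 1) => A) 0 ≫ biproduct.ι (fun _ : Fin (0 + 1) => A) 0 =
      𝟙 (⨁ (fun _ : Fin (0 + 1) => A)) := by
    refine biproduct.hom_ext _ _ fun j ↦ ?_
    have hj : j = 0 := Fin.ext (by have := j.isLt; omega)
    subst hj
    rw [Category.assoc, biproduct.ι_π_self, Category.comp_id, Category.id_comp]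
  haveI : IsIso (biproduct.π (fun _ : Fin (0 + 1) => A) 0) :=
    ⟨⟨biproduct.ι (fun _ : Fin (0 + 1) => A) 0, hπι, biproduct.ι_π_self _ _⟩⟩
  exact AbelianVariety.isIsogeny_of_isIso _

/-- **`dim(V_ρ ∩ ker(ψ^* - z))` is an isogeny invariant**: along an isogeny `f : A ⟶ B` intertwining `φ_A, φ_B` and
`ψ_A, ψ_B`, `f^*` maps `V_ρ(B) ∩ ker(ψ_B^* - z)` isomorphically onto `V_ρ(A) ∩ ker(ψ_A^* - z)` (the seat's
`eigenspace_map_eq_of_isIsogeny_of_comm`, `f^*` injective). [cite: MoonenZarhin1998WeilClasses, §1 («everything only depends on X up to isogeny», chunk p0002 L45–L46)]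
[cite: vanGeemen1994HodgeAV, 3.6 and proof of Lemma 5.2] -/
theorem finrank_eigenspace_inf_eigenspace_eq_of_isIsogeny_of_comm {A B : AbelianVariety ℂ} {φ φ' : A ⟶ A}
    {ψ ψ' : B ⟶ B} {f : A ⟶ B} (hfi : AbelianVariety.IsIsogeny f) (hf : f ≫ ψ = φ ≫ f) (hf' : f ≫ ψ' = φ' ≫ f)
    (ρ z : ℂ) :
    Module.finrank ℂ ↥((pullbackOne A φ).eigenspace ρ ⊓ (pullbackOne A φ').eigenspace z) =
      Module.finrank ℂ ↥((pullbackOne B ψ).eigenspace ρ ⊓ (pullbackOne B ψ').eigenspace z) := by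
  have hinj := (complexBetti_map_bijective_of_isIsogeny hfi 1).1
  rw [← eigenspace_map_eq_of_isIsogeny_of_comm hfi hf ρ, ← eigenspace_map_eq_of_isIsogeny_of_comm hfi hf' z,
    ← Submodule.map_inf _ hinj]
  exact (LinearEquiv.finrank_eq (Submodule.equivMapOfInjective _ hinj _)).symm

end PowerOne

section Carrier

variable {A : AbelianVariety ℂ} {h : complexBetti A.X 2} {ψ α β φ : A ⟶ A} {P Q : Polynomial ℤ} {e m : ℕ}

/-- An eigenvalue of `φ^*` is a complex root of any `P ∈ ℤ[T]` with `P(φ) = 0` (`P(φ)^* = P̄(φ^*)`).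
[cite: LangeBirkenhake1992, §1.1] -/
theorem eval₂_eq_zero_of_eigenspace_pullbackOne_ne_bot
    (hφ : Polynomial.eval₂ (Int.castRingHom (CategoryTheory.End A)) (φ : CategoryTheory.End A) P = 0) {ρ : ℂ}
    (hρ : (pullbackOne A φ).eigenspace ρ ≠ ⊥) : Polynomial.eval₂ (Int.castRingHom ℂ) ρ P = 0 := by
  obtain ⟨x, hx, hx0⟩ := (Submodule.ne_bot_iff _).1 hρ
  have h1 := pullbackOne_eval₂ φ P
  rw [hφ] at h1
  have h0 : pullbackOne A ((0 : CategoryTheory.End A) :) = 0 := pullbackOne_zero_eq_zero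
  rw [h0] at h1
  have h2 : (P.map (Int.castRingHom ℂ)).eval ρ • x = 0 := by
    rw [← aeval_apply_of_mem_eigenspace' hx, ← h1, LinearMap.zero_apply]
  have h3 := (smul_eq_zero.1 h2).resolve_right hx0
  rwa [Polynomial.eval_map] at h3

/-- **Under «`End⁰(A) = ℚ⟨ψ, α, β⟩`» with `ψ` commuting with `α, β`, everything in `E ⊗ ℂ = ℂ[ψ^*]` commutes with every
pull-back `g^*`** (`N g ∈ ℤ⟨ψ, α, β⟩`, whose pull-backs commute with `ψ^*`; `E` is central in `D`).
[cite: MoonenZarhin1998WeilClasses, §1 («let E be the center of D», chunk p0002 L46–L47)] [cite: LangeBirkenhake1992, §1.1] -/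
theorem pullbackOne_comm_of_mem_adjoin_singleton_of_forall_exists_zsmul_mem_closure_triple
    (hψα : ψ ≫ α = α ≫ ψ) (hψβ : ψ ≫ β = β ≫ ψ)
    (hD : ∀ g : A ⟶ A, ∃ N : ℤ, N ≠ 0 ∧ End.of (N • g) ∈ Subring.closure {End.of ψ, End.of α, End.of β})
    {S : Module.End ℂ (complexBetti A.X 1)}
    (hS : S ∈ Algebra.adjoin ℂ ({pullbackOne A ψ} : Set (Module.End ℂ (complexBetti A.X 1)))) (g : A ⟶ A) :
    S * pullbackOne A g = pullbackOne A g * S := by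
  obtain ⟨N, hN0, hN⟩ := hD g
  have h1 : pullbackOne A (N • g) ∈ Algebra.adjoin ℂ
      ({pullbackOne A ψ, pullbackOne A α, pullbackOne A β} : Set (Module.End ℂ (complexBetti A.X 1))) :=
    pullbackOne_mem_adjoin_triple_of_mem_closure hN
  -- `ℂ⟨ψ^*, α^*, β^*⟩` commutes with `ψ^*`
  have hψα' : pullbackOne A ψ * pullbackOne A α = pullbackOne A α * pullbackOne A ψ := by
    rw [← pullbackOne_comp_eq_mul, hψα, pullbackOne_comp_eq_mul]
  have hψβ' : pullbackOne A ψ * pullbackOne A β = pullbackOne A β * pullbackOne A ψ := by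
    rw [← pullbackOne_comp_eq_mul, hψβ, pullbackOne_comp_eq_mul]
  have h2 : pullbackOne A (N • g) ∈ Subalgebra.centralizer ℂ ({pullbackOne A ψ} : Set (Module.End ℂ (complexBetti A.X 1))) := by
    refine Algebra.adjoin_le ?_ h1
    intro x hx
    rw [SetLike.mem_coe, Subalgebra.mem_centralizer_iff]
    intro y hy
    rw [Set.mem_singleton_iff.1 hy]
    rcases hx with rfl | rfl | hx
    · rfl
    · exact hψα'
    · rw [Set.mem_singleton_iff.1 hx]
      exact hψβ'
  -- hence `S ∈ ℂ[ψ^*]` commutes with `(N g)^* = N g^*`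
  have h3 : S ∈ Subalgebra.centralizer ℂ ({pullbackOne A (N • g)} : Set (Module.End ℂ (complexBetti A.X 1))) := by
    refine Algebra.adjoin_le ?_ hS
    intro x hx
    rw [SetLike.mem_coe, Subalgebra.mem_centralizer_iff]
    intro y hy
    rw [Set.mem_singleton_iff.1 hy, Set.mem_singleton_iff.1 hx]
    exact ((Subalgebra.mem_centralizer_iff ℂ).1 h2 _ (Set.mem_singleton _)).symm
  have h4 := (Subalgebra.mem_centralizer_iff ℂ).1 h3 _ (Set.mem_singleton _)
  rw [pullbackOne_zsmul, smul_mul_assoc, mul_smul_comm] at h4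
  exact (smul_right_injective _ (Int.cast_ne_zero.2 hN0) h4).symm

/-- **THE DICHOTOMY AS A LOGICAL EQUIVALENCE: `W_F ⊗ ℂ ⊓ 𝒟ᵐ ⊗ ℂ = ⊥ ↔ ¬ (W_F ⊗ ℂ ≤ 𝒟ᵐ ⊗ ℂ)`** for every complex
abelian variety, `h ∈ B¹ ⊗ ℂ` with `Q_h` non-degenerate, `P(φ) = 0`, `e · 2m = 2 dim A`, `m ≠ 0`: «either all classes
in `W_F` are decomposable, or all non-zero classes in `W_F` are exceptional» — the tree's `S(A)(h)(ℂ)`-criteria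
(`…_iff_forall_detOnEigenspace_eq_one`, `…_iff_exists_detOnEigenspace_ne_one`) are each other's negations, and
`W_F ≠ 0`. [cite: MoonenZarhin1998WeilClasses, §1 Criterion (2) (chunk p0003 L59–L67)] [cite: Milne1999LefschetzClasses, §1 p. 643, Thm. 3.2, Cor. 4.5] -/
theorem weilClassesField_inf_divisorClassesSpan_eq_bot_iff_not_le_divisorClassesSpan (hPm : P.Monic)
    (hPe : P.natDegree = e) (hPirr : Irreducible (P.map (Int.castRingHom ℚ)))
    (hφ : Polynomial.eval₂ (Int.castRingHom (CategoryTheory.End A)) (φ : CategoryTheory.End A) P = 0)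
    (her : e * (2 * m) = 2 * A.dim) (hm : m ≠ 0) (hh : h ∈ hodgeClassSpan A.dim A.X 1)
    (hnd : ∀ x : complexBetti A.X 1, (∀ y, polarizationPairingOne A.X h (A.dim - 1) x y = 0) → x = 0) :
    weilClassesField A φ P (2 * m) ⊓ divisorClassesSpan A.X A.dim m = ⊥ ↔
      ¬ weilClassesField A φ P (2 * m) ≤ divisorClassesSpan A.X A.dim m := by
  refine ⟨fun hbot hle ↦ ?_, fun hnle ↦ ?_⟩
  · rw [inf_eq_left.2 hle] at hbot
    obtain ⟨γ, hγW, -, hγ0⟩ := exists_isRationalClass_ne_zero_mem_weilClassesField hPm hPe hPirr hφ her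
    rw [hbot, Submodule.mem_bot] at hγW
    exact hγ0 hγW
  · rw [weilClassesField_le_divisorClassesSpan_iff_forall_detOnEigenspace_eq_one hPm hPe hPirr hφ her hh hnd] at hnle
    push Not at hnle
    obtain ⟨u, hu, ρ, hρ, hne⟩ := hnle
    exact (weilClassesField_inf_divisorClassesSpan_eq_bot_iff_exists_detOnEigenspace_ne_one hPm hPe hPirr hφ her hm hh
      hnd).2 ⟨u, hu, ρ, hρ, hne⟩

end Carrier

/-! ### §3 THE TYPE-3 ROW WITH `m = 1`: `W_F` decomposable iff `φ^* ∈ E ⊗ ℂ`, all non-zero classes exceptional iff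
`φ^* ∉ E ⊗ ℂ` -/

section TypeThreeSimple

variable {A : AbelianVariety ℂ} {h : complexBetti A.X 2} {ψ α β φ : A ⟶ A} {P Q qa qb : Polynomial ℤ} {e m : ℕ}
  {N : ℤ} {f : Polynomial ℤ}

/-- **«`F ⊆ E ⊗ ℂ`» ⟹ DECOMPOSABLE, for any `A`**: if `ψ^*` is `Q_h`-symmetric and `φ^* ∈ ℂ[ψ^*]`, then
`W_F ⊗ ℂ ≤ 𝒟ᵐ ⊗ ℂ` (`ℂ[ψ^*]` consists of `Q_h`-symmetric operators; the tree's symmetric case).  The print, types 1 and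
3 with `m = 1`: «`F ⊆ B`(`= E`) ⟹ `G_div(X)` acts trivially on `W_F`». [cite: MoonenZarhin1998WeilClasses, §1 Criterion (2) and its proof, m = 1 (chunk p0003 L59–L90)]
[cite: Milne1999LefschetzClasses, Thm. 3.2, Cor. 4.5] -/
theorem weilClassesField_le_divisorClassesSpan_of_mem_adjoin_singleton_of_symm (hA : 0 < A.dim) (hPm : P.Monic)
    (hPe : P.natDegree = e) (hPirr : Irreducible (P.map (Int.castRingHom ℚ)))
    (hφ : Polynomial.eval₂ (Int.castRingHom (CategoryTheory.End A)) (φ : CategoryTheory.End A) P = 0)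
    (her : e * (2 * m) = 2 * A.dim) (hh : h ∈ hodgeClassSpan A.dim A.X 1)
    (hnd : ∀ x : complexBetti A.X 1, (∀ y, polarizationPairingOne A.X h (A.dim - 1) x y = 0) → x = 0)
    (hψsym : ∀ v w : complexBetti A.X 1, polarizationPairingOne A.X h (A.dim - 1) (pullbackOne A ψ v) w =
      polarizationPairingOne A.X h (A.dim - 1) v (pullbackOne A ψ w))
    (hF : pullbackOne A φ ∈ Algebra.adjoin ℂ ({pullbackOne A ψ} : Set (Module.End ℂ (complexBetti A.X 1)))) :
    weilClassesField A φ P (2 * m) ≤ divisorClassesSpan A.X A.dim m :=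
  weilClassesField_le_divisorClassesSpan_of_symm hA hPm hPe hPirr hφ her hh hnd
    (polarizationPairingOne_symm_of_mem_adjoin_singleton hψsym hF)

/-- **«`F ⊆ E`» IN `End(A)` ⟹ DECOMPOSABLE**: if `N φ = f(ψ)` in `End(A)` for some `N ≠ 0`, `f ∈ ℤ[X]`, with `ψ`
Rosati-symmetric, then `W_F ⊗ ℂ ≤ 𝒟ᵐ ⊗ ℂ` (`φ^* = N⁻¹ f̄(ψ^*) ∈ ℂ[ψ^*]`). [cite: MoonenZarhin1998WeilClasses, §1 Criterion (2) and its proof, m = 1 («F ⊆ B»; chunk p0003 L59–L90)]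
[cite: Milne1999LefschetzClasses, Thm. 3.2, Cor. 4.5] [cite: LangeBirkenhake1992, §1.1] -/
theorem weilClassesField_le_divisorClassesSpan_of_zsmul_eq_eval₂_of_symm (hA : 0 < A.dim) (hPm : P.Monic)
    (hPe : P.natDegree = e) (hPirr : Irreducible (P.map (Int.castRingHom ℚ)))
    (hφ : Polynomial.eval₂ (Int.castRingHom (CategoryTheory.End A)) (φ : CategoryTheory.End A) P = 0)
    (her : e * (2 * m) = 2 * A.dim) (hh : h ∈ hodgeClassSpan A.dim A.X 1)
    (hnd : ∀ x : complexBetti A.X 1, (∀ y, polarizationPairingOne A.X h (A.dim - 1) x y = 0) → x = 0)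
    (hψsym : ∀ v w : complexBetti A.X 1, polarizationPairingOne A.X h (A.dim - 1) (pullbackOne A ψ v) w =
      polarizationPairingOne A.X h (A.dim - 1) v (pullbackOne A ψ w))
    (hN : N ≠ 0) (hNφ : N • φ = Polynomial.eval₂ (Int.castRingHom (CategoryTheory.End A)) (ψ : CategoryTheory.End A) f) :
    weilClassesField A φ P (2 * m) ≤ divisorClassesSpan A.X A.dim m := by
  refine weilClassesField_le_divisorClassesSpan_of_mem_adjoin_singleton_of_symm hA hPm hPe hPirr hφ her hh hnd hψsym ?_
  have h1 : (N : ℂ) • pullbackOne A φ = aeval (pullbackOne A ψ) (f.map (Int.castRingHom ℂ)) := by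
    rw [← pullbackOne_zsmul, hNφ]
    exact pullbackOne_eval₂ ψ f
  have h2 : pullbackOne A φ = ((N : ℂ)⁻¹) • aeval (pullbackOne A ψ) (f.map (Int.castRingHom ℂ)) := by
    rw [← h1, smul_smul, inv_mul_cancel₀ (Int.cast_ne_zero.2 hN), one_smul]
  rw [h2]
  exact Subalgebra.smul_mem _ (Polynomial.aeval_mem_adjoin_singleton _ _) _

/-- **MOONEN–ZARHIN's CRITERION (2), TYPE 3 WITH `m = 1` — DECOMPOSABLE IFF `φ^* ∈ E ⊗ ℂ`.**  Let `A` be a complex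
abelian variety of positive dimension, `h ∈ B¹(A) ⊗ ℂ` with `h^{dim A} ≠ 0` and `Q_h` non-degenerate, and let
`ψ, α, β ∈ End(A)` present `End⁰(A)` as a definite quaternion algebra `D` over `E = ℚ(ψ)`: `ψ` Rosati-symmetric,
`Q(ψ) = 0` (`Q` monic irreducible over `ℚ`); `α, β` ROSATI-SKEW, `ψα = αψ`, `ψβ = βψ`, `αβ = -βα`, `α² = a(ψ)`,
`β² = b(ψ)` (`a, b ∈ ℤ[X]` non-vanishing at the complex roots of `Q`); and every `g ∈ End(A)` has a non-zero integer
multiple in `ℤ⟨ψ, α, β⟩`.  Then for every `φ ∈ End(A)` with `P(φ) = 0` (`P` monic irreducible of degree `e`,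
`e · 2m = 2 dim A`): `W_F ⊗ ℂ ≤ 𝒟ᵐ ⊗ ℂ` IFF `φ^* ∈ ℂ[ψ^*] = E ⊗ ℂ`.  «⟸»: `ℂ[ψ^*]` is `Q_h`-symmetric.  «⟹»: transport
to `A¹ = ⨁_{Fin 1} A` along the isogeny `π₀` (§2), apply the seat's parity criterion for powers
(`weilClassesField_biproduct_le_divisorClassesSpan_iff_forall_dvd_of_definiteQuaternionOver_End`, `n = 0`): every
per-place exponent is even, i.e. `dim ker(ψ^* - z) ∣ dim(V_ρ ∩ ker(ψ^* - z))`; by §1 this makes `φ^*` a polynomial in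
`ψ^*`.  In the print: «`G_div(X)` acts as the identity on `W_F` if and only if `F ⊆ B`», with `B = E` for type 3, `m = 1`.
[cite: MoonenZarhin1998WeilClasses, §1 Criterion (2), case «Y is of Type 3, m = 1 and F ⊄ E» and its proof (chunk p0003 L59–L90); Table 1 (chunk p0002 L60–L97)]
[cite: Milne1999LefschetzClasses, §1 p. 643, Thm. 3.2, Cor. 4.5] [cite: LangeBirkenhake1992, §1.1, Ch. 5 §5 (PDF p. 138)] -/
theorem weilClassesField_le_divisorClassesSpan_iff_mem_adjoin_singleton_of_definiteQuaternionOver_End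
    (hA : 0 < A.dim) (hh : h ∈ hodgeClassSpan A.dim A.X 1) (htop : lefschetzPow h (A.dim - 1) 2 h ≠ 0)
    (hnd : ∀ x : complexBetti A.X 1, (∀ y, polarizationPairingOne A.X h (A.dim - 1) x y = 0) → x = 0)
    (hψsym : ∀ v w : complexBetti A.X 1, polarizationPairingOne A.X h (A.dim - 1) (pullbackOne A ψ v) w =
      polarizationPairingOne A.X h (A.dim - 1) v (pullbackOne A ψ w))
    (hQm : Q.Monic) (hQirr : Irreducible (Q.map (Int.castRingHom ℚ)))
    (hψQ : Polynomial.eval₂ (Int.castRingHom (CategoryTheory.End A)) (ψ : CategoryTheory.End A) Q = 0)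
    (hα2 : α ≫ α = Polynomial.eval₂ (Int.castRingHom (CategoryTheory.End A)) (ψ : CategoryTheory.End A) qa)
    (hqa : ∀ z : ℂ, (Q.map (Int.castRingHom ℂ)).IsRoot z → (qa.map (Int.castRingHom ℂ)).eval z ≠ 0)
    (hβ2 : β ≫ β = Polynomial.eval₂ (Int.castRingHom (CategoryTheory.End A)) (ψ : CategoryTheory.End A) qb)
    (hqb : ∀ z : ℂ, (Q.map (Int.castRingHom ℂ)).IsRoot z → (qb.map (Int.castRingHom ℂ)).eval z ≠ 0)
    (hanti : α ≫ β = -(β ≫ α))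
    (hαskew : ∀ v w : complexBetti A.X 1, polarizationPairingOne A.X h (A.dim - 1) (pullbackOne A α v) w =
      -polarizationPairingOne A.X h (A.dim - 1) v (pullbackOne A α w))
    (hβskew : ∀ v w : complexBetti A.X 1, polarizationPairingOne A.X h (A.dim - 1) (pullbackOne A β v) w =
      -polarizationPairingOne A.X h (A.dim - 1) v (pullbackOne A β w))
    (hψα : ψ ≫ α = α ≫ ψ) (hψβ : ψ ≫ β = β ≫ ψ)
    (hD : ∀ g : A ⟶ A, ∃ N : ℤ, N ≠ 0 ∧ End.of (N • g) ∈ Subring.closure {End.of ψ, End.of α, End.of β})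
    (hPm : P.Monic) (hPe : P.natDegree = e) (hPirr : Irreducible (P.map (Int.castRingHom ℚ)))
    (hφ : Polynomial.eval₂ (Int.castRingHom (CategoryTheory.End A)) (φ : CategoryTheory.End A) P = 0)
    (her : e * (2 * m) = 2 * A.dim) :
    weilClassesField A φ P (2 * m) ≤ divisorClassesSpan A.X A.dim m ↔
      pullbackOne A φ ∈ Algebra.adjoin ℂ ({pullbackOne A ψ} : Set (Module.End ℂ (complexBetti A.X 1))) := by
  classical
  refine ⟨fun hle ↦ ?_, fun hF ↦ weilClassesField_le_divisorClassesSpan_of_mem_adjoin_singleton_of_symm hA hPm hPe hPirr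
    hφ her hh hnd hψsym hF⟩
  haveI : Module.Finite ℂ (complexBetti A.X 1) := abelianVarietyCohomologyExteriorH1_holds.finite_one A
  -- transport to `A¹ = ⨁_{Fin 1} A` along `π₀`
  have hfi := isIsogeny_biproduct_π_fin_one (A := A)
  have hf : biproduct.π (fun _ : Fin (0 + 1) => A) 0 ≫ φ =
      (biproduct.map fun _ : Fin (0 + 1) => φ) ≫ biproduct.π (fun _ : Fin (0 + 1) => A) 0 :=
    (biproduct.map_π (fun _ : Fin (0 + 1) => φ) 0).symm
  have hfψ : biproduct.π (fun _ : Fin (0 + 1) => A) 0 ≫ ψ =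
      (biproduct.map fun _ : Fin (0 + 1) => ψ) ≫ biproduct.π (fun _ : Fin (0 + 1) => A) 0 :=
    (biproduct.map_π (fun _ : Fin (0 + 1) => ψ) 0).symm
  have hle₁ : weilClassesField (⨁ (fun _ : Fin (0 + 1) => A)) (biproduct.map fun _ : Fin (0 + 1) => φ) P (2 * m) ≤
      divisorClassesSpan (⨁ (fun _ : Fin (0 + 1) => A)).X (⨁ (fun _ : Fin (0 + 1) => A)).dim m :=
    (weilClassesField_le_divisorClassesSpan_iff_of_isIsogeny_of_comm hfi hf P m).2 hle
  have hφ₁ := biproduct_map_const_eval₂_eq_zero (n := 0) hφ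
  have her₁ : e * (2 * m) = 2 * ((0 + 1) * A.dim) := by rw [zero_add, one_mul]; exact her
  have hdvd₁ := (weilClassesField_biproduct_le_divisorClassesSpan_iff_forall_dvd_of_definiteQuaternionOver_End (n := 0)
    hA hh htop hnd hψsym hQm hQirr hψQ hα2 hqa hβ2 hqb hanti hαskew hβskew hψα hψβ hD hPm hPe hPirr hφ₁ her₁).1 hle₁
  -- back on `A`: divisibility at every place, hence `φ^* ∈ ℂ[ψ^*]` by §1
  have hQ0 : Q.map (Int.castRingHom ℂ) ≠ 0 := (hQm.map _).ne_zero
  refine mem_adjoin_singleton_of_forall_finrank_eigenspace_dvd (s := (Q.map (Int.castRingHom ℂ)).roots.toFinset)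
    (iSup_eigenspace_pullbackOne_eq_top hQirr hψQ) (fun z hz ↦ ?_)
    (pullbackOne_comm_of_mem_adjoin_singleton_of_forall_exists_zsmul_mem_closure_triple hψα hψβ hD
      (Algebra.self_mem_adjoin_singleton ℂ _) φ).symm (fun z ρ hne ↦ ?_)
  · rw [Multiset.mem_toFinset, Polynomial.mem_roots hQ0, Polynomial.IsRoot.def, Polynomial.eval_map]
    exact eval₂_eq_zero_of_eigenspace_pullbackOne_ne_bot hψQ hz
  · have hρ : Polynomial.eval₂ (Int.castRingHom ℂ) ρ P = 0 :=
      eval₂_eq_zero_of_eigenspace_pullbackOne_ne_bot hφ fun h0 ↦ hne (by rw [h0, bot_inf_eq])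
    have hz : (Q.map (Int.castRingHom ℂ)).IsRoot z := by
      rw [Polynomial.IsRoot.def, Polynomial.eval_map]
      exact eval₂_eq_zero_of_eigenspace_pullbackOne_ne_bot hψQ fun h0 ↦ hne (by rw [h0, inf_bot_eq])
    have h1 := hdvd₁ ρ hρ z hz
    rwa [finrank_eigenspace_inf_eigenspace_eq_of_isIsogeny_of_comm hfi hf hfψ ρ z] at h1

/-- **MOONEN–ZARHIN's CRITERION (2), TYPE 3 WITH `m = 1` — «all non-zero classes in `W_F` are exceptional … precisely
when `F ⊄ E`»**: under the hypotheses of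
`weilClassesField_le_divisorClassesSpan_iff_mem_adjoin_singleton_of_definiteQuaternionOver_End`,
`W_F ⊗ ℂ ⊓ 𝒟ᵐ ⊗ ℂ = ⊥` IFF `φ^* ∉ ℂ[ψ^*] = E ⊗ ℂ`. [cite: MoonenZarhin1998WeilClasses, §1 Criterion (2), case «Y is of Type 3, m = 1 and F ⊄ E» and its proof (chunk p0003 L59–L90)]
[cite: Milne1999LefschetzClasses, §1 p. 643, Thm. 3.2, Cor. 4.5] [cite: LangeBirkenhake1992, §1.1, Ch. 5 §5 (PDF p. 138)] -/
theorem weilClassesField_inf_divisorClassesSpan_eq_bot_iff_not_mem_adjoin_singleton_of_definiteQuaternionOver_End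
    (hA : 0 < A.dim) (hh : h ∈ hodgeClassSpan A.dim A.X 1) (htop : lefschetzPow h (A.dim - 1) 2 h ≠ 0)
    (hnd : ∀ x : complexBetti A.X 1, (∀ y, polarizationPairingOne A.X h (A.dim - 1) x y = 0) → x = 0)
    (hψsym : ∀ v w : complexBetti A.X 1, polarizationPairingOne A.X h (A.dim - 1) (pullbackOne A ψ v) w =
      polarizationPairingOne A.X h (A.dim - 1) v (pullbackOne A ψ w))
    (hQm : Q.Monic) (hQirr : Irreducible (Q.map (Int.castRingHom ℚ)))
    (hψQ : Polynomial.eval₂ (Int.castRingHom (CategoryTheory.End A)) (ψ : CategoryTheory.End A) Q = 0)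
    (hα2 : α ≫ α = Polynomial.eval₂ (Int.castRingHom (CategoryTheory.End A)) (ψ : CategoryTheory.End A) qa)
    (hqa : ∀ z : ℂ, (Q.map (Int.castRingHom ℂ)).IsRoot z → (qa.map (Int.castRingHom ℂ)).eval z ≠ 0)
    (hβ2 : β ≫ β = Polynomial.eval₂ (Int.castRingHom (CategoryTheory.End A)) (ψ : CategoryTheory.End A) qb)
    (hqb : ∀ z : ℂ, (Q.map (Int.castRingHom ℂ)).IsRoot z → (qb.map (Int.castRingHom ℂ)).eval z ≠ 0)
    (hanti : α ≫ β = -(β ≫ α))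
    (hαskew : ∀ v w : complexBetti A.X 1, polarizationPairingOne A.X h (A.dim - 1) (pullbackOne A α v) w =
      -polarizationPairingOne A.X h (A.dim - 1) v (pullbackOne A α w))
    (hβskew : ∀ v w : complexBetti A.X 1, polarizationPairingOne A.X h (A.dim - 1) (pullbackOne A β v) w =
      -polarizationPairingOne A.X h (A.dim - 1) v (pullbackOne A β w))
    (hψα : ψ ≫ α = α ≫ ψ) (hψβ : ψ ≫ β = β ≫ ψ)
    (hD : ∀ g : A ⟶ A, ∃ N : ℤ, N ≠ 0 ∧ End.of (N • g) ∈ Subring.closure {End.of ψ, End.of α, End.of β})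
    (hPm : P.Monic) (hPe : P.natDegree = e) (hPirr : Irreducible (P.map (Int.castRingHom ℚ)))
    (hφ : Polynomial.eval₂ (Int.castRingHom (CategoryTheory.End A)) (φ : CategoryTheory.End A) P = 0)
    (her : e * (2 * m) = 2 * A.dim) :
    weilClassesField A φ P (2 * m) ⊓ divisorClassesSpan A.X A.dim m = ⊥ ↔
      pullbackOne A φ ∉ Algebra.adjoin ℂ ({pullbackOne A ψ} : Set (Module.End ℂ (complexBetti A.X 1))) := by
  have hm : m ≠ 0 := by
    rintro rfl
    rw [mul_zero, mul_zero] at her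
    omega
  rw [weilClassesField_inf_divisorClassesSpan_eq_bot_iff_not_le_divisorClassesSpan hPm hPe hPirr hφ her hm hh hnd,
    weilClassesField_le_divisorClassesSpan_iff_mem_adjoin_singleton_of_definiteQuaternionOver_End hA hh htop hnd hψsym hQm
      hQirr hψQ hα2 hqa hβ2 hqb hanti hαskew hβskew hψα hψβ hD hPm hPe hPirr hφ her]

/-- **THE DICHOTOMY for a definite quaternion algebra and `m = 1`**: `W_F ⊗ ℂ ≤ 𝒟ᵐ ⊗ ℂ` or `W_F ⊗ ℂ ⊓ 𝒟ᵐ ⊗ ℂ = ⊥`,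
according as `φ^* ∈ ℂ[ψ^*]` or not. [cite: MoonenZarhin1998WeilClasses, §1 Criterion (2) («either all classes in W_F are decomposable, or all non-zero classes in W_F are exceptional»; chunk p0003 L59–L69)]
[cite: Milne1999LefschetzClasses, §1 p. 643, Thm. 3.2, Cor. 4.5] -/
theorem weilClassesField_le_or_inf_divisorClassesSpan_eq_bot_of_definiteQuaternionOver_End
    (hA : 0 < A.dim) (hh : h ∈ hodgeClassSpan A.dim A.X 1) (htop : lefschetzPow h (A.dim - 1) 2 h ≠ 0)
    (hnd : ∀ x : complexBetti A.X 1, (∀ y, polarizationPairingOne A.X h (A.dim - 1) x y = 0) → x = 0)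
    (hψsym : ∀ v w : complexBetti A.X 1, polarizationPairingOne A.X h (A.dim - 1) (pullbackOne A ψ v) w =
      polarizationPairingOne A.X h (A.dim - 1) v (pullbackOne A ψ w))
    (hQm : Q.Monic) (hQirr : Irreducible (Q.map (Int.castRingHom ℚ)))
    (hψQ : Polynomial.eval₂ (Int.castRingHom (CategoryTheory.End A)) (ψ : CategoryTheory.End A) Q = 0)
    (hα2 : α ≫ α = Polynomial.eval₂ (Int.castRingHom (CategoryTheory.End A)) (ψ : CategoryTheory.End A) qa)
    (hqa : ∀ z : ℂ, (Q.map (Int.castRingHom ℂ)).IsRoot z → (qa.map (Int.castRingHom ℂ)).eval z ≠ 0)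
    (hβ2 : β ≫ β = Polynomial.eval₂ (Int.castRingHom (CategoryTheory.End A)) (ψ : CategoryTheory.End A) qb)
    (hqb : ∀ z : ℂ, (Q.map (Int.castRingHom ℂ)).IsRoot z → (qb.map (Int.castRingHom ℂ)).eval z ≠ 0)
    (hanti : α ≫ β = -(β ≫ α))
    (hαskew : ∀ v w : complexBetti A.X 1, polarizationPairingOne A.X h (A.dim - 1) (pullbackOne A α v) w =
      -polarizationPairingOne A.X h (A.dim - 1) v (pullbackOne A α w))
    (hβskew : ∀ v w : complexBetti A.X 1, polarizationPairingOne A.X h (A.dim - 1) (pullbackOne A β v) w =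
      -polarizationPairingOne A.X h (A.dim - 1) v (pullbackOne A β w))
    (hψα : ψ ≫ α = α ≫ ψ) (hψβ : ψ ≫ β = β ≫ ψ)
    (hD : ∀ g : A ⟶ A, ∃ N : ℤ, N ≠ 0 ∧ End.of (N • g) ∈ Subring.closure {End.of ψ, End.of α, End.of β})
    (hPm : P.Monic) (hPe : P.natDegree = e) (hPirr : Irreducible (P.map (Int.castRingHom ℚ)))
    (hφ : Polynomial.eval₂ (Int.castRingHom (CategoryTheory.End A)) (φ : CategoryTheory.End A) P = 0)
    (her : e * (2 * m) = 2 * A.dim) :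
    weilClassesField A φ P (2 * m) ≤ divisorClassesSpan A.X A.dim m ∨
      weilClassesField A φ P (2 * m) ⊓ divisorClassesSpan A.X A.dim m = ⊥ := by
  by_cases hF : pullbackOne A φ ∈ Algebra.adjoin ℂ ({pullbackOne A ψ} : Set (Module.End ℂ (complexBetti A.X 1)))
  · exact Or.inl ((weilClassesField_le_divisorClassesSpan_iff_mem_adjoin_singleton_of_definiteQuaternionOver_End hA hh
      htop hnd hψsym hQm hQirr hψQ hα2 hqa hβ2 hqb hanti hαskew hβskew hψα hψβ hD hPm hPe hPirr hφ her).2 hF)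
  · exact Or.inr ((weilClassesField_inf_divisorClassesSpan_eq_bot_iff_not_mem_adjoin_singleton_of_definiteQuaternionOver_End
      hA hh htop hnd hψsym hQm hQirr hψQ hα2 hqa hβ2 hqb hanti hαskew hβskew hψα hψβ hD hPm hPe hPirr hφ her).2 hF)

/-- **DECOMPOSABLE ⟹ `φ` IS CENTRAL IN `End(A)`** («`F ⊆ E`, `E` the centre of `D = End⁰(A)`», the End-level necessary
form): if `W_F ⊗ ℂ ≤ 𝒟ᵐ ⊗ ℂ` then `g ≫ φ = φ ≫ g` for every `g ∈ End(A)` — `φ^* ∈ ℂ[ψ^*]` commutes with every `g^*`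
(§2), and the representation of `End(A)` on `H¹(A(ℂ); ℂ)` is faithful.
[cite: MoonenZarhin1998WeilClasses, §1 Criterion (2), type 3 with m = 1 («F ⊆ E», E = Z(D); chunk p0002 L46–L47, p0003 L59–L90)]
[cite: LangeBirkenhake1992, §1.1 (faithfulness of the rational representation)] -/
theorem comp_comm_of_weilClassesField_le_divisorClassesSpan_of_definiteQuaternionOver_End
    (hA : 0 < A.dim) (hh : h ∈ hodgeClassSpan A.dim A.X 1) (htop : lefschetzPow h (A.dim - 1) 2 h ≠ 0)
    (hnd : ∀ x : complexBetti A.X 1, (∀ y, polarizationPairingOne A.X h (A.dim - 1) x y = 0) → x = 0)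
    (hψsym : ∀ v w : complexBetti A.X 1, polarizationPairingOne A.X h (A.dim - 1) (pullbackOne A ψ v) w =
      polarizationPairingOne A.X h (A.dim - 1) v (pullbackOne A ψ w))
    (hQm : Q.Monic) (hQirr : Irreducible (Q.map (Int.castRingHom ℚ)))
    (hψQ : Polynomial.eval₂ (Int.castRingHom (CategoryTheory.End A)) (ψ : CategoryTheory.End A) Q = 0)
    (hα2 : α ≫ α = Polynomial.eval₂ (Int.castRingHom (CategoryTheory.End A)) (ψ : CategoryTheory.End A) qa)
    (hqa : ∀ z : ℂ, (Q.map (Int.castRingHom ℂ)).IsRoot z → (qa.map (Int.castRingHom ℂ)).eval z ≠ 0)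
    (hβ2 : β ≫ β = Polynomial.eval₂ (Int.castRingHom (CategoryTheory.End A)) (ψ : CategoryTheory.End A) qb)
    (hqb : ∀ z : ℂ, (Q.map (Int.castRingHom ℂ)).IsRoot z → (qb.map (Int.castRingHom ℂ)).eval z ≠ 0)
    (hanti : α ≫ β = -(β ≫ α))
    (hαskew : ∀ v w : complexBetti A.X 1, polarizationPairingOne A.X h (A.dim - 1) (pullbackOne A α v) w =
      -polarizationPairingOne A.X h (A.dim - 1) v (pullbackOne A α w))
    (hβskew : ∀ v w : complexBetti A.X 1, polarizationPairingOne A.X h (A.dim - 1) (pullbackOne A β v) w =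
      -polarizationPairingOne A.X h (A.dim - 1) v (pullbackOne A β w))
    (hψα : ψ ≫ α = α ≫ ψ) (hψβ : ψ ≫ β = β ≫ ψ)
    (hD : ∀ g : A ⟶ A, ∃ N : ℤ, N ≠ 0 ∧ End.of (N • g) ∈ Subring.closure {End.of ψ, End.of α, End.of β})
    (hPm : P.Monic) (hPe : P.natDegree = e) (hPirr : Irreducible (P.map (Int.castRingHom ℚ)))
    (hφ : Polynomial.eval₂ (Int.castRingHom (CategoryTheory.End A)) (φ : CategoryTheory.End A) P = 0)
    (her : e * (2 * m) = 2 * A.dim)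
    (hle : weilClassesField A φ P (2 * m) ≤ divisorClassesSpan A.X A.dim m) (g : A ⟶ A) :
    g ≫ φ = φ ≫ g := by
  have hF := (weilClassesField_le_divisorClassesSpan_iff_mem_adjoin_singleton_of_definiteQuaternionOver_End hA hh htop hnd
    hψsym hQm hQirr hψQ hα2 hqa hβ2 hqb hanti hαskew hβskew hψα hψβ hD hPm hPe hPirr hφ her).1 hle
  have hc := pullbackOne_comm_of_mem_adjoin_singleton_of_forall_exists_zsmul_mem_closure_triple hψα hψβ hD hF g
  have e1 : pullbackOne A (g ≫ φ) = pullbackOne A (φ ≫ g) := by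
    rw [pullbackOne_comp_eq_mul, pullbackOne_comp_eq_mul, hc]
  have e0 : (complexBetti.map (g ≫ φ - φ ≫ g).hom.hom.hom 1).hom = 0 := by
    rw [complexBetti_map_sub_one, ModuleCat.hom_sub]
    exact sub_eq_zero.2 e1
  exact sub_eq_zero.1 (ComplexMultiplication.hom_eq_zero_of_complexBetti_map_one_eq_zero _ e0)

/-- **`φ` NOT CENTRAL IN `End(A)` ⟹ ALL NON-ZERO WEIL CLASSES OF `F = ℚ(φ)` ARE EXCEPTIONAL** («`Y` is of Type 3,
`m = 1` and `F ⊄ E`», End-level sufficient form: `F ⊄ Z(End⁰ A)`). [cite: MoonenZarhin1998WeilClasses, §1 Criterion (2), case «Y is of Type 3, m = 1 and F ⊄ E» (chunk p0003 L59–L69)]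
[cite: Milne1999LefschetzClasses, §1 p. 643, Thm. 3.2, Cor. 4.5] [cite: LangeBirkenhake1992, §1.1, Ch. 5 §5 (PDF p. 138)] -/
theorem weilClassesField_inf_divisorClassesSpan_eq_bot_of_comp_ne_comp_of_definiteQuaternionOver_End
    (hA : 0 < A.dim) (hh : h ∈ hodgeClassSpan A.dim A.X 1) (htop : lefschetzPow h (A.dim - 1) 2 h ≠ 0)
    (hnd : ∀ x : complexBetti A.X 1, (∀ y, polarizationPairingOne A.X h (A.dim - 1) x y = 0) → x = 0)
    (hψsym : ∀ v w : complexBetti A.X 1, polarizationPairingOne A.X h (A.dim - 1) (pullbackOne A ψ v) w =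
      polarizationPairingOne A.X h (A.dim - 1) v (pullbackOne A ψ w))
    (hQm : Q.Monic) (hQirr : Irreducible (Q.map (Int.castRingHom ℚ)))
    (hψQ : Polynomial.eval₂ (Int.castRingHom (CategoryTheory.End A)) (ψ : CategoryTheory.End A) Q = 0)
    (hα2 : α ≫ α = Polynomial.eval₂ (Int.castRingHom (CategoryTheory.End A)) (ψ : CategoryTheory.End A) qa)
    (hqa : ∀ z : ℂ, (Q.map (Int.castRingHom ℂ)).IsRoot z → (qa.map (Int.castRingHom ℂ)).eval z ≠ 0)
    (hβ2 : β ≫ β = Polynomial.eval₂ (Int.castRingHom (CategoryTheory.End A)) (ψ : CategoryTheory.End A) qb)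
    (hqb : ∀ z : ℂ, (Q.map (Int.castRingHom ℂ)).IsRoot z → (qb.map (Int.castRingHom ℂ)).eval z ≠ 0)
    (hanti : α ≫ β = -(β ≫ α))
    (hαskew : ∀ v w : complexBetti A.X 1, polarizationPairingOne A.X h (A.dim - 1) (pullbackOne A α v) w =
      -polarizationPairingOne A.X h (A.dim - 1) v (pullbackOne A α w))
    (hβskew : ∀ v w : complexBetti A.X 1, polarizationPairingOne A.X h (A.dim - 1) (pullbackOne A β v) w =
      -polarizationPairingOne A.X h (A.dim - 1) v (pullbackOne A β w))
    (hψα : ψ ≫ α = α ≫ ψ) (hψβ : ψ ≫ β = β ≫ ψ)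
    (hD : ∀ g : A ⟶ A, ∃ N : ℤ, N ≠ 0 ∧ End.of (N • g) ∈ Subring.closure {End.of ψ, End.of α, End.of β})
    (hPm : P.Monic) (hPe : P.natDegree = e) (hPirr : Irreducible (P.map (Int.castRingHom ℚ)))
    (hφ : Polynomial.eval₂ (Int.castRingHom (CategoryTheory.End A)) (φ : CategoryTheory.End A) P = 0)
    (her : e * (2 * m) = 2 * A.dim) {g : A ⟶ A} (hg : g ≫ φ ≠ φ ≫ g) :
    weilClassesField A φ P (2 * m) ⊓ divisorClassesSpan A.X A.dim m = ⊥ := by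
  rcases weilClassesField_le_or_inf_divisorClassesSpan_eq_bot_of_definiteQuaternionOver_End hA hh htop hnd hψsym hQm hQirr
    hψQ hα2 hqa hβ2 hqb hanti hαskew hβskew hψα hψβ hD hPm hPe hPirr hφ her with hle | hbot
  · exact absurd (comp_comm_of_weilClassesField_le_divisorClassesSpan_of_definiteQuaternionOver_End hA hh htop hnd hψsym
      hQm hQirr hψQ hα2 hqa hβ2 hqb hanti hαskew hβskew hψα hψβ hD hPm hPe hPirr hφ her hle g) hg
  · exact hbot

end TypeThreeSimple

/-! ### §4 Centre `ℚ` (`e₀ = 1`): `End⁰(A) = D = ℚ⟨α, β⟩` definite — decomposable iff `φ^* ∈ ℂ · 1` iff `F = ℚ` -/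

section CentreRat

variable {A : AbelianVariety ℂ} {h : complexBetti A.X 2} {α β φ : A ⟶ A} {P : Polynomial ℤ} {e m : ℕ} {a b : ℤ}

/-- The complex roots of a monic `P ∈ ℤ[T]` irreducible over `ℚ` form a finset of cardinality `deg P` (they are simple,
with nodal polynomial `P̄`). [folklore] -/
private theorem card_roots_toFinset_eq_natDegree (hPm : P.Monic) (hPirr : Irreducible (P.map (Int.castRingHom ℚ))) :
    (P.map (Int.castRingHom ℂ)).roots.toFinset.card = P.natDegree := by
  classical
  have hPc : P.map (Int.castRingHom ℂ) = (P.map (Int.castRingHom ℚ)).map (algebraMap ℚ ℂ) := by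
    rw [Polynomial.map_map, RingHom.ext_int ((algebraMap ℚ ℂ).comp (Int.castRingHom ℚ)) (Int.castRingHom ℂ)]
  have hsep : (P.map (Int.castRingHom ℂ)).Separable := by
    rw [hPc]
    exact hPirr.separable.map
  have hmon : (P.map (Int.castRingHom ℂ)).Monic := hPm.map _
  have hnodup : (P.map (Int.castRingHom ℂ)).roots.Nodup := Polynomial.nodup_roots hsep
  have hnodal : Lagrange.nodal (P.map (Int.castRingHom ℂ)).roots.toFinset id = P.map (Int.castRingHom ℂ) := by
    have hsplit := (IsAlgClosed.splits (P.map (Int.castRingHom ℂ))).eq_prod_roots_of_monic hmon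
    rw [Lagrange.nodal_eq, ← Multiset.toFinset_eq hnodup, Finset.prod_mk]
    exact hsplit.symm
  have h := Lagrange.natDegree_nodal (s := (P.map (Int.castRingHom ℂ)).roots.toFinset) (v := id)
  rw [hnodal, hPm.natDegree_map] at h
  exact h.symm

/-- **TYPE 3 OVER `ℚ`, `m = 1`: `W_F ⊗ ℂ ≤ 𝒟ᵐ ⊗ ℂ ↔ φ^* ∈ ℂ · 1`** — for `α, β ∈ End(A)` Rosati-skew, `αβ = -βα`,
`α² = [a]`, `β² = [b]` (`a, b ∈ ℤ ∖ {0}`), «`End⁰(A) = ℚ⟨α, β⟩`» (every `g ∈ End(A)` has a non-zero multiple in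
`ℤ⟨α, β⟩`), `h ∈ B¹ ⊗ ℂ` with `h^{dim A} ≠ 0` and `Q_h` non-degenerate, `P(φ) = 0`, `e · 2m = 2 dim A`: §3 with `ψ = 𝟙`,
`E = ℚ`, `E ⊗ ℂ = ℂ · 1`. [cite: MoonenZarhin1998WeilClasses, §1 Criterion (2), case «Y is of Type 3, m = 1 and F ⊄ E» with E = ℚ (chunk p0003 L59–L90)]
[cite: Milne1999LefschetzClasses, §1 p. 643, Thm. 3.2, Cor. 4.5] -/
theorem weilClassesField_le_divisorClassesSpan_iff_exists_eq_smul_one_of_definiteQuaternion_End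
    (hA : 0 < A.dim) (hh : h ∈ hodgeClassSpan A.dim A.X 1) (htop : lefschetzPow h (A.dim - 1) 2 h ≠ 0)
    (hnd : ∀ x : complexBetti A.X 1, (∀ y, polarizationPairingOne A.X h (A.dim - 1) x y = 0) → x = 0)
    (ha : a ≠ 0) (hα2 : α ≫ α = a • 𝟙 A) (hb : b ≠ 0) (hβ2 : β ≫ β = b • 𝟙 A) (hanti : α ≫ β = -(β ≫ α))
    (hαskew : ∀ v w : complexBetti A.X 1, polarizationPairingOne A.X h (A.dim - 1) (pullbackOne A α v) w =
      -polarizationPairingOne A.X h (A.dim - 1) v (pullbackOne A α w))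
    (hβskew : ∀ v w : complexBetti A.X 1, polarizationPairingOne A.X h (A.dim - 1) (pullbackOne A β v) w =
      -polarizationPairingOne A.X h (A.dim - 1) v (pullbackOne A β w))
    (hD : ∀ g : A ⟶ A, ∃ N : ℤ, N ≠ 0 ∧ End.of (N • g) ∈ Subring.closure {End.of (𝟙 A), End.of α, End.of β})
    (hPm : P.Monic) (hPe : P.natDegree = e) (hPirr : Irreducible (P.map (Int.castRingHom ℚ)))
    (hφ : Polynomial.eval₂ (Int.castRingHom (CategoryTheory.End A)) (φ : CategoryTheory.End A) P = 0)
    (her : e * (2 * m) = 2 * A.dim) :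
    weilClassesField A φ P (2 * m) ≤ divisorClassesSpan A.X A.dim m ↔
      ∃ c : ℂ, pullbackOne A φ = c • (1 : Module.End ℂ (complexBetti A.X 1)) := by
  have hψsym : ∀ v w : complexBetti A.X 1, polarizationPairingOne A.X h (A.dim - 1) (pullbackOne A (𝟙 A) v) w =
      polarizationPairingOne A.X h (A.dim - 1) v (pullbackOne A (𝟙 A) w) := by
    intro v w
    rw [pullbackOne_id_eq_one, Module.End.one_apply, Module.End.one_apply]
  have hQm : (X - C 1 : Polynomial ℤ).Monic := monic_X_sub_C 1
  have hQirr : Irreducible ((X - C 1 : Polynomial ℤ).map (Int.castRingHom ℚ)) := by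
    rw [Polynomial.map_sub, Polynomial.map_X, Polynomial.map_C, map_one]
    exact irreducible_X_sub_C 1
  have hψQ : Polynomial.eval₂ (Int.castRingHom (CategoryTheory.End A)) (𝟙 A : CategoryTheory.End A) (X - C 1) = 0 := by
    rw [eval₂_sub, eval₂_X, eval₂_C, map_one]
    exact sub_self _
  have hα2' : α ≫ α = Polynomial.eval₂ (Int.castRingHom (CategoryTheory.End A)) (𝟙 A : CategoryTheory.End A) (C a) := by
    rw [eval₂_C, eq_intCast, hα2, ← zsmul_one]
    rfl
  have hβ2' : β ≫ β = Polynomial.eval₂ (Int.castRingHom (CategoryTheory.End A)) (𝟙 A : CategoryTheory.End A) (C b) := by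
    rw [eval₂_C, eq_intCast, hβ2, ← zsmul_one]
    rfl
  have hqa : ∀ z : ℂ, ((X - C 1 : Polynomial ℤ).map (Int.castRingHom ℂ)).IsRoot z →
      ((C a : Polynomial ℤ).map (Int.castRingHom ℂ)).eval z ≠ 0 := fun z _ ↦ by
    rw [Polynomial.map_C, eval_C, eq_intCast]
    exact Int.cast_ne_zero.2 ha
  have hqb : ∀ z : ℂ, ((X - C 1 : Polynomial ℤ).map (Int.castRingHom ℂ)).IsRoot z →
      ((C b : Polynomial ℤ).map (Int.castRingHom ℂ)).eval z ≠ 0 := fun z _ ↦ by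
    rw [Polynomial.map_C, eval_C, eq_intCast]
    exact Int.cast_ne_zero.2 hb
  have h1α : 𝟙 A ≫ α = α ≫ 𝟙 A := by rw [Category.id_comp, Category.comp_id]
  have h1β : 𝟙 A ≫ β = β ≫ 𝟙 A := by rw [Category.id_comp, Category.comp_id]
  rw [weilClassesField_le_divisorClassesSpan_iff_mem_adjoin_singleton_of_definiteQuaternionOver_End hA hh htop hnd hψsym
    hQm hQirr hψQ hα2' hqa hβ2' hqb hanti hαskew hβskew h1α h1β hD hPm hPe hPirr hφ her, pullbackOne_id_eq_one]
  constructor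
  · intro hF
    have hbot : pullbackOne A φ ∈ (⊥ : Subalgebra ℂ (Module.End ℂ (complexBetti A.X 1))) :=
      Algebra.adjoin_le (Set.singleton_subset_iff.2 (one_mem _)) hF
    obtain ⟨c, hc⟩ := Algebra.mem_bot.1 hbot
    exact ⟨c, by rw [← hc, Algebra.algebraMap_eq_smul_one]⟩
  · rintro ⟨c, hc⟩
    rw [hc]
    exact Subalgebra.smul_mem _ (one_mem _) _

/-- **TYPE 3 OVER `ℚ`, `m = 1`: `W_F ⊗ ℂ ≤ 𝒟ᵐ ⊗ ℂ ↔ deg P = 1` («`F ⊆ E = ℚ`» means `F = ℚ`): EVERY SUBFIELD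
`F ≠ ℚ` OF A DEFINITE QUATERNION ALGEBRA `End⁰(A)` OVER `ℚ` HAS ONLY EXCEPTIONAL NON-ZERO WEIL CLASSES.**  «⟹»: if
`φ^* = c · 1` then every complex root `ρ` of `P` (an eigenvalue: `dim V_ρ = 2m > 0`) equals `c`, and `P` has `deg P`
simple roots; «⟸»: `P = X + k` gives `φ = -k`, `φ^* = -k · 1`. [cite: MoonenZarhin1998WeilClasses, §1 Criterion (2), case «Y is of Type 3, m = 1 and F ⊄ E» with E = ℚ (chunk p0003 L59–L90)]
[cite: Milne1999LefschetzClasses, §1 p. 643, Thm. 3.2, Cor. 4.5] -/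
theorem weilClassesField_le_divisorClassesSpan_iff_natDegree_eq_one_of_definiteQuaternion_End
    (hA : 0 < A.dim) (hh : h ∈ hodgeClassSpan A.dim A.X 1) (htop : lefschetzPow h (A.dim - 1) 2 h ≠ 0)
    (hnd : ∀ x : complexBetti A.X 1, (∀ y, polarizationPairingOne A.X h (A.dim - 1) x y = 0) → x = 0)
    (ha : a ≠ 0) (hα2 : α ≫ α = a • 𝟙 A) (hb : b ≠ 0) (hβ2 : β ≫ β = b • 𝟙 A) (hanti : α ≫ β = -(β ≫ α))
    (hαskew : ∀ v w : complexBetti A.X 1, polarizationPairingOne A.X h (A.dim - 1) (pullbackOne A α v) w =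
      -polarizationPairingOne A.X h (A.dim - 1) v (pullbackOne A α w))
    (hβskew : ∀ v w : complexBetti A.X 1, polarizationPairingOne A.X h (A.dim - 1) (pullbackOne A β v) w =
      -polarizationPairingOne A.X h (A.dim - 1) v (pullbackOne A β w))
    (hD : ∀ g : A ⟶ A, ∃ N : ℤ, N ≠ 0 ∧ End.of (N • g) ∈ Subring.closure {End.of (𝟙 A), End.of α, End.of β})
    (hPm : P.Monic) (hPe : P.natDegree = e) (hPirr : Irreducible (P.map (Int.castRingHom ℚ)))
    (hφ : Polynomial.eval₂ (Int.castRingHom (CategoryTheory.End A)) (φ : CategoryTheory.End A) P = 0)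
    (her : e * (2 * m) = 2 * A.dim) :
    weilClassesField A φ P (2 * m) ≤ divisorClassesSpan A.X A.dim m ↔ e = 1 := by
  classical
  have hm : m ≠ 0 := by
    rintro rfl
    rw [mul_zero, mul_zero] at her
    omega
  rw [weilClassesField_le_divisorClassesSpan_iff_exists_eq_smul_one_of_definiteQuaternion_End hA hh htop hnd ha hα2 hb hβ2
    hanti hαskew hβskew hD hPm hPe hPirr hφ her]
  constructor
  · rintro ⟨c, hc⟩
    -- every complex root of `P` equals `c`
    have hroots : ∀ ρ : ℂ, Polynomial.eval₂ (Int.castRingHom ℂ) ρ P = 0 → ρ = c := by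
      intro ρ hρ
      have hdim := finrank_eigenspace_eq_of_root hPm hPe hPirr hφ her hρ
      have hne : (pullbackOne A φ).eigenspace ρ ≠ ⊥ := by
        intro h0
        have h' : Module.finrank ℂ ↥((pullbackOne A φ).eigenspace ρ) = 0 := by rw [h0, finrank_bot]
        rw [h'] at hdim
        omega
      obtain ⟨x, hx, hx0⟩ := (Submodule.ne_bot_iff _).1 hne
      have h1 : ρ • x = c • x := by
        rw [← Module.End.mem_eigenspace_iff.1 hx, hc, LinearMap.smul_apply, Module.End.one_apply]
      have h2 : (ρ - c) • x = 0 := by rw [sub_smul, h1, sub_self]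
      exact sub_eq_zero.1 ((smul_eq_zero.1 h2).resolve_right hx0)
    -- so the finset of roots has at most one element, and `deg P` of them
    have hsub : (P.map (Int.castRingHom ℂ)).roots.toFinset ⊆ {c} := by
      intro ρ hρ
      rw [Multiset.mem_toFinset, Polynomial.mem_roots (hPm.map _).ne_zero, IsRoot.def, Polynomial.eval_map] at hρ
      rw [Finset.mem_singleton]
      exact hroots ρ hρ
    have hcard := Finset.card_le_card hsub
    rw [Finset.card_singleton, card_roots_toFinset_eq_natDegree hPm hPirr, hPe] at hcard
    have hpos : 0 < e := by
      rw [← hPe, ← hPm.natDegree_map (Int.castRingHom ℚ)]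
      exact Polynomial.natDegree_pos_iff_degree_pos.2 (Polynomial.degree_pos_of_irreducible hPirr)
    omega
  · intro he
    rw [he] at hPe
    have hP1 := hPm.eq_X_add_C hPe
    rw [hP1, eval₂_add, eval₂_X, eval₂_C, eq_intCast] at hφ
    have hφ' : (φ : A ⟶ A) = (-P.coeff 0) • 𝟙 A := by
      have h1 := eq_neg_of_add_eq_zero_left hφ
      rw [h1, ← Int.cast_neg, ← zsmul_one]
      rfl
    refine ⟨((-P.coeff 0 : ℤ) : ℂ), ?_⟩
    rw [hφ', pullbackOne_zsmul_id]

/-- **… and `W_F ⊗ ℂ ⊓ 𝒟ᵐ ⊗ ℂ = ⊥ ↔ deg P ≠ 1`**: for `End⁰(A)` a definite quaternion algebra over `ℚ` (as presented)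
and ANY `φ ∈ End(A) ∖ ℤ`, all non-zero Weil classes of `F = ℚ(φ)` are exceptional.
[cite: MoonenZarhin1998WeilClasses, §1 Criterion (2), case «Y is of Type 3, m = 1 and F ⊄ E» with E = ℚ (chunk p0003 L59–L90)]
[cite: Milne1999LefschetzClasses, §1 p. 643, Thm. 3.2, Cor. 4.5] -/
theorem weilClassesField_inf_divisorClassesSpan_eq_bot_iff_natDegree_ne_one_of_definiteQuaternion_End
    (hA : 0 < A.dim) (hh : h ∈ hodgeClassSpan A.dim A.X 1) (htop : lefschetzPow h (A.dim - 1) 2 h ≠ 0)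
    (hnd : ∀ x : complexBetti A.X 1, (∀ y, polarizationPairingOne A.X h (A.dim - 1) x y = 0) → x = 0)
    (ha : a ≠ 0) (hα2 : α ≫ α = a • 𝟙 A) (hb : b ≠ 0) (hβ2 : β ≫ β = b • 𝟙 A) (hanti : α ≫ β = -(β ≫ α))
    (hαskew : ∀ v w : complexBetti A.X 1, polarizationPairingOne A.X h (A.dim - 1) (pullbackOne A α v) w =
      -polarizationPairingOne A.X h (A.dim - 1) v (pullbackOne A α w))
    (hβskew : ∀ v w : complexBetti A.X 1, polarizationPairingOne A.X h (A.dim - 1) (pullbackOne A β v) w =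
      -polarizationPairingOne A.X h (A.dim - 1) v (pullbackOne A β w))
    (hD : ∀ g : A ⟶ A, ∃ N : ℤ, N ≠ 0 ∧ End.of (N • g) ∈ Subring.closure {End.of (𝟙 A), End.of α, End.of β})
    (hPm : P.Monic) (hPe : P.natDegree = e) (hPirr : Irreducible (P.map (Int.castRingHom ℚ)))
    (hφ : Polynomial.eval₂ (Int.castRingHom (CategoryTheory.End A)) (φ : CategoryTheory.End A) P = 0)
    (her : e * (2 * m) = 2 * A.dim) :
    weilClassesField A φ P (2 * m) ⊓ divisorClassesSpan A.X A.dim m = ⊥ ↔ e ≠ 1 := by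
  have hm : m ≠ 0 := by
    rintro rfl
    rw [mul_zero, mul_zero] at her
    omega
  rw [weilClassesField_inf_divisorClassesSpan_eq_bot_iff_not_le_divisorClassesSpan hPm hPe hPirr hφ her hm hh hnd,
    weilClassesField_le_divisorClassesSpan_iff_natDegree_eq_one_of_definiteQuaternion_End hA hh htop hnd ha hα2 hb hβ2 hanti
      hαskew hβskew hD hPm hPe hPirr hφ her]

end CentreRat

end Literature.AlgebraicGeometry.HodgeTheory

end
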